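import Mathlib
import HarnessLib
import Summits.HubbardSuperconductivity.HubbardSuperconductivity.Theorems.KLProgrammeKLRegimeTwoVolumeTowerBaseGridDataMKit
import Summits.HubbardSuperconductivity.HubbardSuperconductivity.Theorems.KLProgrammeKLRegimeTwoVolumeTowerBaseGridDataMDefs
import Summits.HubbardSuperconductivity.HubbardSuperconductivity.Theorems.KLProgrammeKLRegimeTwoVolumeFrameResponse

/-!
# Route `KLProgramme` — crux K3, VL child `KLRegimeVolumeLimitV17F2` (stmt-HubbardSuperconductivity-20440), atom HB1, GRID HALF (assembly step G3-3):
# THE ONE-INSTANCE CONSTRUCTOR OF `TowerGridDataM` from the suppliers' currencies (cell gate-hubbard-kl, seat p3 g18; `--supports` 20440)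

At one instance `(L, b, M)` with admissible frames `Kc` (coarse, also the covariance frame) and `Kf` (fine), `klBetaMin ≤ β ≤ L`, this file builds
`Nonempty (TowerGridDataM L b M β U μ Kc Kf ε …)` (`ε = imagTimeWeight β M`) from data in the currencies the landed suppliers deliver:

* the `gridLabelWt`-weighted rows/columns `≤ (N/β)·A` of the `Λ₁` grid covariance at `Kc` on both lattices (k3c4-p2's `rowWt_/colWt_uvCovAt_le`) — all nine
  row-type fields by `…GridDataMKit.gridRowsScaled_of_rowWt` (`aC = a = a′ = aw = m = m′ = 2A`, `tT = 2A/(R+1)`); sups and Gram constants (`2(7+6593)`,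
  `√(2(7+6593))`) by `norm_uvCovAt_apply_le` / `isGramBoundedR_uvCovAt_of_frameOK`; the Gram path by `isGramBoundedR_add_smul_sub` (`κE = κ + κ`);
* the fine-lattice frame-swap triple `sE, cc` (p3's `…TowerBaseGridFrameSwapData`) and the sectional tail `Te` (k3c4-p2's `…SectionalMomentFrameOK`) as hypotheses;
* the frame kernels' position first moments `≤ F` (`EngineV8.frameKernel_weightedL1_le`) and the frame-increment weight `≤ e₀`: the budgets `NW, NV` are the canonical
  input budgets (`…TowerBaseGridInput`), `ND` the first-moment glue budget (M4a‴), `E` the mismatch; their `normV`'s by `towerGrid_normV_inputBudget_le` /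
  `normV_slotOne_le`;
* the output profile `Nw` = the geometric majorant of `gridOutputProfile_majorant` (unit partition function included), its `normV`'s by `normV_gridOutputMajorant_le`.

* **`towerGridDataM_mk`**.

Proofs only; no definition.  Honest framing: a constructor over landed bounds; nothing asserts HB1, any stub of 20440, K3, VL or superconductivity.
[cite: BenfattoGiulianiMastropietro2006, §2.1 (2.5), §2.5 (2.52)–(2.55), §2.7 (2.70)–(2.71a), §3 (3.3)]
-/

noncomputable section

namespace Summit.HubbardSuperconductivity.HubbardSuperconductivity.Theorems.TwoVolumeSource

set_option linter.dupNamespace false -- summit = problem name (single-conjunct summit), D-0017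

open Finset Literature.MathematicalPhysics.QuantumLattice GrassmannAlgebra Literature.Probability.LatticeModels
  Literature.Probability.LatticeModels.BattleFederbush
open Literature.MathematicalPhysics.QuantumLattice.FermiRG
open Summit.HubbardSuperconductivity.HubbardSuperconductivity.Theorems.KLProgrammeLegKernels
open Summit.HubbardSuperconductivity.HubbardSuperconductivity.Theorems.KLRegimeSplit
open Summit.HubbardSuperconductivity.HubbardSuperconductivity.Theorems.EngineV8
open Summit.HubbardSuperconductivity.HubbardSuperconductivity.Theorems.TwoVolumeDefect

set_option maxHeartbeats 1600000 in -- one structure with 39 fields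
/-- **THE ONE-INSTANCE CONSTRUCTOR OF `TowerGridDataM`** (see the module docstring for the provenance of each field).  Constants: `κ = κ′ = √(2(7+6593))`,
`κE = κ + κ′`, `aC = a = a′ = aw = m = m′ = 2A`, `s = s′ = 2(7+6593)`, `tT = 2A/(R+1)`, `νW = ((e²(κE+ρS))²F + (e²(κE+ρS))⁴|U|)/2`,
`Θ = ((e²(κ+ρ′))²F + (e²(κ+ρ′))⁴|U|)/2 + (e²(κ+ρ′))²F + (e²(κ+ρ′))²ē/2` (`ē ≥ e₀` a volume-free cap), `νD = (e²(κ+ρ′))²F`, `eE = (e²(κ+ρ′))²e₀/2`,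
`νf = (eΘ₀/(1−θb))/(1−q_f²)`, `ν₂ = (eΘ₀/(1−θb))/(1−q₂²)`. [cite: BenfattoGiulianiMastropietro2006, §2.5 (2.52)–(2.55), §2.7 (2.70)–(2.71a), §3 (3.3)] -/
theorem towerGridDataM_mk {L b M : ℕ} [NeZero L] [NeZero (b * L)] [NeZero M] {β U μ : ℝ} {R : RenConsts} {Nsc : ℕ} {Kc Kf : TrigPolyC4v}
    (hβ : klBetaMin ≤ β) (hβL : β ≤ L) (hKc : FrameOK R U Nsc μ Kc) (hKf : FrameOK R U Nsc μ Kf)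
    -- `gridLabelWt` rows/columns of the `Λ₁` grid covariance at the coarse frame, on both lattices
    {A : ℝ} (hA : 0 < A)
    (hrow : ∀ X, ∑ Y, ‖((hubbardGridSub L M β (klGridN M)).transpose * hubbardCovAboveCT L M β μ 0 Kc (klScale klE0 1) *
        hubbardGridSub L M β (klGridN M)) X Y‖ * gridLabelWt L (klGridN M) β {gridLegPos X, gridLegPos Y} ≤ ((klGridN M : ℕ) : ℝ) / β * A)
    (hcol : ∀ Y, ∑ X, ‖((hubbardGridSub L M β (klGridN M)).transpose * hubbardCovAboveCT L M β μ 0 Kc (klScale klE0 1) *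
        hubbardGridSub L M β (klGridN M)) X Y‖ * gridLabelWt L (klGridN M) β {gridLegPos X, gridLegPos Y} ≤ ((klGridN M : ℕ) : ℝ) / β * A)
    (hrow' : ∀ X, ∑ Y, ‖((hubbardGridSub (b * L) M β (klGridN M)).transpose * hubbardCovAboveCT (b * L) M β μ 0 Kc (klScale klE0 1) *
        hubbardGridSub (b * L) M β (klGridN M)) X Y‖ * gridLabelWt (b * L) (klGridN M) β {gridLegPos X, gridLegPos Y} ≤ ((klGridN M : ℕ) : ℝ) / β * A)
    (hcol' : ∀ Y, ∑ X, ‖((hubbardGridSub (b * L) M β (klGridN M)).transpose * hubbardCovAboveCT (b * L) M β μ 0 Kc (klScale klE0 1) *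
        hubbardGridSub (b * L) M β (klGridN M)) X Y‖ * gridLabelWt (b * L) (klGridN M) β {gridLegPos X, gridLegPos Y} ≤ ((klGridN M : ℕ) : ℝ) / β * A)
    -- the fine-lattice frame swap (entry sup, `ε`-scaled rows and columns)
    {sE cc : ℝ}
    (hsE : ∀ x y, ‖((hubbardGridSub (b * L) M β (klGridN M)).transpose *
          hubbardCovAboveCT (b * L) M β μ 0 Kf (klScale klE0 1) * hubbardGridSub (b * L) M β (klGridN M) -
        (hubbardGridSub (b * L) M β (klGridN M)).transpose *
          hubbardCovAboveCT (b * L) M β μ 0 Kc (klScale klE0 1) * hubbardGridSub (b * L) M β (klGridN M)) x y‖ ≤ sE)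
    (hRr : ∀ x, imagTimeWeight β M * ∑ y, ‖((hubbardGridSub (b * L) M β (klGridN M)).transpose *
          hubbardCovAboveCT (b * L) M β μ 0 Kf (klScale klE0 1) * hubbardGridSub (b * L) M β (klGridN M) -
        (hubbardGridSub (b * L) M β (klGridN M)).transpose *
          hubbardCovAboveCT (b * L) M β μ 0 Kc (klScale klE0 1) * hubbardGridSub (b * L) M β (klGridN M)) x y‖ ≤ cc)
    (hCr : ∀ y, imagTimeWeight β M * ∑ x, ‖((hubbardGridSub (b * L) M β (klGridN M)).transpose *
          hubbardCovAboveCT (b * L) M β μ 0 Kf (klScale klE0 1) * hubbardGridSub (b * L) M β (klGridN M) -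
        (hubbardGridSub (b * L) M β (klGridN M)).transpose *
          hubbardCovAboveCT (b * L) M β μ 0 Kc (klScale klE0 1) * hubbardGridSub (b * L) M β (klGridN M)) x y‖ ≤ cc)
    -- pin radius above the coarse degree, the consumer's second radius, the sectional tails at the pin radius
    {R₀ R₀' : ℕ} (hRK : Kc.degree < R₀) {Te : ℝ}
    (hsec : ∀ (X' : GridLeg (GridPoint (b * L) (klGridN M))) (t : Fin (klGridN M)) (σ c : Fin 2),
      ∑ y ∈ univ.filter (fun y : TorusSite 2 (b * L) => R₀ < Torus.tnorm (X'.1.1.2 - y)),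
        ‖((hubbardGridSub (b * L) M β (klGridN M)).transpose * hubbardCovAboveCT (b * L) M β μ 0 Kc (klScale klE0 1) *
          hubbardGridSub (b * L) M β (klGridN M)) X' (((t, y), σ), c)‖ ≤ Te)
    -- position first moments of the two frames' hopping kernels, the frame-increment weight
    {F : ℝ} (hFc : ∑ z : TorusSite 2 L, ‖framePosKernel L Kc z‖ * (1 + torusSiteDist z 0) ≤ F)
    (hFf : ∑ z : TorusSite 2 (b * L), ‖framePosKernel (b * L) Kf z‖ * (1 + torusSiteDist z 0) ≤ F)
    {e₀ ē : ℝ} (he₀ : (fsub Kf Kc).coeffNorm 0 ≤ e₀) (hē : e₀ ≤ ē)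
    -- field radii, the input-budget majorant and the smallness of the coarse grid step, the two geometric ratios
    {ρS ρ' ρ₂ ρf ρg Θ₀ θb : ℝ} (hρS : 0 < ρS) (hρ' : 0 < ρ') (hρ₂ : 0 < ρ₂) (hρf : 0 < ρf) (hρg : 0 < ρg) (hΘ₀0 : 0 ≤ Θ₀)
    (hΘ₀ : ((Real.exp 2 * (Real.sqrt (2 * (7 + 6593)) + ρg)) ^ 2 * F + (Real.exp 2 * (Real.sqrt (2 * (7 + 6593)) + ρg)) ^ 4 * |U|) / 2 ≤ Θ₀)
    (hθb : Real.exp 1 * (2 * A) * Θ₀ / Real.sqrt (2 * (7 + 6593)) ^ 2 ≤ θb) (hθb1 : θb < 1)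
    (hqf : Real.exp 2 * (Real.sqrt (2 * (7 + 6593)) + Real.sqrt (2 * (7 + 6593)) + ρf) * ρg⁻¹ < 1)
    (hq₂ : Real.exp 2 * (Real.sqrt (2 * (7 + 6593)) + Real.sqrt (2 * (7 + 6593)) +
      (Real.sqrt (2 * (7 + 6593)) + Real.sqrt (2 * (7 + 6593)) + (Real.sqrt (2 * (7 + 6593)) + Real.sqrt (2 * (7 + 6593)))) + ρ₂) * ρg⁻¹ < 1) :
    Nonempty (TowerGridDataM L b M β U μ Kc Kf (imagTimeWeight β M)
      (Real.sqrt (2 * (7 + 6593)) + Real.sqrt (2 * (7 + 6593))) (2 * A) (Real.sqrt (2 * (7 + 6593))) (Real.sqrt (2 * (7 + 6593))) ρS ρ' ρ₂ ρf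
      (2 * A) (2 * A) (2 * A) (2 * A) (2 * A) (2 * (7 + 6593)) (2 * (7 + 6593))
      (((Real.exp 2 * (Real.sqrt (2 * (7 + 6593)) + ρ')) ^ 2 * F + (Real.exp 2 * (Real.sqrt (2 * (7 + 6593)) + ρ')) ^ 4 * |U|) / 2 +
        (Real.exp 2 * (Real.sqrt (2 * (7 + 6593)) + ρ')) ^ 2 * F + (Real.exp 2 * (Real.sqrt (2 * (7 + 6593)) + ρ')) ^ 2 * ē / 2)
      (((Real.exp 2 * (Real.sqrt (2 * (7 + 6593)) + Real.sqrt (2 * (7 + 6593)) + ρS)) ^ 2 * F +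
        (Real.exp 2 * (Real.sqrt (2 * (7 + 6593)) + Real.sqrt (2 * (7 + 6593)) + ρS)) ^ 4 * |U|) / 2)
      (Real.exp 1 * Θ₀ / (1 - θb) / (1 - (Real.exp 2 * (Real.sqrt (2 * (7 + 6593)) + Real.sqrt (2 * (7 + 6593)) + ρf) * ρg⁻¹) ^ 2))
      (Real.exp 1 * Θ₀ / (1 - θb) / (1 - (Real.exp 2 * (Real.sqrt (2 * (7 + 6593)) + Real.sqrt (2 * (7 + 6593)) +
        (Real.sqrt (2 * (7 + 6593)) + Real.sqrt (2 * (7 + 6593)) + (Real.sqrt (2 * (7 + 6593)) + Real.sqrt (2 * (7 + 6593)))) + ρ₂) * ρg⁻¹) ^ 2))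
      ((Real.exp 2 * (Real.sqrt (2 * (7 + 6593)) + ρ')) ^ 2 * F)
      sE cc ((Real.exp 2 * (Real.sqrt (2 * (7 + 6593)) + ρ')) ^ 2 * e₀ / 2) (2 * A / ((R₀ : ℝ) + 1)) Te R₀ R₀') := by
  classical
  -- basic facts
  have hβ0 : 0 < β := pos_of_klBetaMin_le hβ
  have hb1 : 1 ≤ b := Nat.pos_of_ne_zero fun hb => NeZero.ne (b * L) (by rw [hb, Nat.zero_mul])
  have hLbL : L ≤ b * L := Nat.le_mul_of_pos_left L hb1
  have hβL' : β ≤ ((b * L : ℕ) : ℝ) := hβL.trans (by exact_mod_cast hLbL)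
  have hM0 : (0 : ℝ) < M := Nat.cast_pos.2 (Nat.pos_of_ne_zero (NeZero.ne M))
  have hε0 : 0 ≤ imagTimeWeight β M := by unfold imagTimeWeight; positivity
  have hΛe : klScale klE0 1 ≤ klE0 := by unfold klScale klE0; norm_num
  set κ : ℝ := Real.sqrt (2 * (7 + 6593)) with hκ
  have hκ0 : 0 < κ := Real.sqrt_pos.2 (by norm_num)
  have hLdvd : L ∣ b * L := dvd_mul_left L b
  have hN : |β| / (klGridN M : ℕ) = imagTimeWeight β M / 2 := by
    rw [abs_of_pos hβ0, imagTimeWeight]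
    simp only [klGridN]
    push_cast
    field_simp
  -- Gram constants and sups
  have hGBc := isGramBoundedR_uvCovAt_of_frameOK (L := L) (M := M) hKc hβ hβL le_rfl hΛe
  have hGBf := isGramBoundedR_uvCovAt_of_frameOK (L := b * L) (M := M) hKc hβ hβL' le_rfl hΛe
  have hGBff := isGramBoundedR_uvCovAt_of_frameOK (L := b * L) (M := M) hKf hβ hβL' le_rfl hΛe
  -- the `ε`-scaled row shapes on both lattices (residues mod `L`)
  obtain ⟨rL1, -, rL3, -, -, -, -⟩ := gridRowsScaled_of_rowWt hβ0 _ hrow hcol (dvd_refl L)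
  obtain ⟨rF1, rF2, -, rF4, rF5, rF6, rF7⟩ := gridRowsScaled_of_rowWt hβ0 _ hrow' hcol' hLdvd
  -- the output profile of the coarse grid action
  have hxL : normV (GridLeg (GridPoint L (klGridN M))) κ ρg
      (fun m' : ℕ => if m' = 1 then |β| / (klGridN M : ℕ) * ∑ z : TorusSite 2 L, ‖framePosKernel L Kc z‖ * (1 + torusSiteDist z 0)
        else if m' = 2 then |U| * |β| / (klGridN M : ℕ) else 0) ≤ imagTimeWeight β M * Θ₀ :=
    (towerGrid_normV_inputBudget_le _ hβ0 U Kc hκ0.le hρg.le hFc).trans (mul_le_mul_of_nonneg_left hΘ₀ hε0)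
  obtain ⟨hZ, hprof⟩ := gridOutputProfile_majorant hKc hβ hβL hA hrow hcol hρg hΘ₀0 hxL hθb hθb1
  -- the slot-`1` budgets
  have hw2 : 0 ≤ (Real.exp 2 * (κ + ρ')) ^ 2 := by positivity
  have hSf0 : 0 ≤ ∑ z : TorusSite 2 (b * L), ‖framePosKernel (b * L) Kf z‖ * (1 + torusSiteDist z 0) :=
    sum_nonneg fun z _ => by have : 0 ≤ torusSiteDist z 0 := Nat.cast_nonneg _; positivity
  have hSc0 : 0 ≤ ∑ z : TorusSite 2 L, ‖framePosKernel L Kc z‖ * (1 + torusSiteDist z 0) :=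
    sum_nonneg fun z _ => by have : 0 ≤ torusSiteDist z 0 := Nat.cast_nonneg _; positivity
  have hF0 : 0 ≤ F := hSc0.trans hFc
  have hND_norm : normV (GridLeg (GridPoint (b * L) (klGridN M))) κ ρ'
      (fun m' : ℕ => if m' = 1 then |β| / (klGridN M : ℕ) * ∑ z : TorusSite 2 (b * L), ‖framePosKernel (b * L) Kf z‖ * (1 + torusSiteDist z 0) +
        |β| / (klGridN M : ℕ) * ∑ z : TorusSite 2 L, ‖framePosKernel L Kc z‖ * (1 + torusSiteDist z 0) else 0) ≤
      imagTimeWeight β M * ((Real.exp 2 * (κ + ρ')) ^ 2 * F) := by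
    refine (normV_slotOne_le hκ0.le hρ'.le (by rw [hN]; positivity)).trans ?_
    rw [hN]
    have h1 : imagTimeWeight β M / 2 * ∑ z : TorusSite 2 (b * L), ‖framePosKernel (b * L) Kf z‖ * (1 + torusSiteDist z 0) +
        imagTimeWeight β M / 2 * ∑ z : TorusSite 2 L, ‖framePosKernel L Kc z‖ * (1 + torusSiteDist z 0) ≤ imagTimeWeight β M * F := by
      nlinarith [mul_le_mul_of_nonneg_left hFf hε0, mul_le_mul_of_nonneg_left hFc hε0]
    nlinarith [mul_le_mul_of_nonneg_left h1 hw2]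
  have hE_norm : normV (GridLeg (GridPoint (b * L) (klGridN M))) κ ρ'
      (fun m' : ℕ => if m' = 1 then |β| / (klGridN M : ℕ) * (fsub Kf Kc).coeffNorm 0 else 0) ≤
      imagTimeWeight β M * ((Real.exp 2 * (κ + ρ')) ^ 2 * e₀ / 2) := by
    have hc0 : 0 ≤ (fsub Kf Kc).coeffNorm 0 := TrigPolyC4v.coeffNorm_nonneg _ _
    refine (normV_slotOne_le hκ0.le hρ'.le (by rw [hN]; positivity)).trans ?_
    rw [hN]
    nlinarith [mul_le_mul_of_nonneg_left he₀ hε0, mul_le_mul_of_nonneg_left (mul_le_mul_of_nonneg_left he₀ hε0) hw2]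
  have hNV_norm : normV (GridLeg (GridPoint (b * L) (klGridN M))) κ ρ'
      (fun m' : ℕ => if m' = 1 then |β| / (klGridN M : ℕ) * ∑ z : TorusSite 2 L, ‖framePosKernel L Kc z‖ * (1 + torusSiteDist z 0)
        else if m' = 2 then |U| * |β| / (klGridN M : ℕ) else 0) ≤
      imagTimeWeight β M * (((Real.exp 2 * (κ + ρ')) ^ 2 * F + (Real.exp 2 * (κ + ρ')) ^ 4 * |U|) / 2) :=
    towerGrid_normV_inputBudget_le _ hβ0 U Kc hκ0.le hρ'.le hFc
  refine ⟨{
    NW := fun m' : ℕ => if m' = 1 then |β| / (klGridN M : ℕ) * ∑ z : TorusSite 2 (b * L), ‖framePosKernel (b * L) Kf z‖ * (1 + torusSiteDist z 0)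
      else if m' = 2 then |U| * |β| / (klGridN M : ℕ) else 0
    Nw := fun m' : ℕ => ρg⁻¹ ^ (2 * m') * (Real.exp 1 * (imagTimeWeight β M * Θ₀) / (1 - θb))
    NV := fun m' : ℕ => if m' = 1 then |β| / (klGridN M : ℕ) * ∑ z : TorusSite 2 L, ‖framePosKernel L Kc z‖ * (1 + torusSiteDist z 0)
      else if m' = 2 then |U| * |β| / (klGridN M : ℕ) else 0
    ND := fun m' : ℕ => if m' = 1 then |β| / (klGridN M : ℕ) * ∑ z : TorusSite 2 (b * L), ‖framePosKernel (b * L) Kf z‖ * (1 + torusSiteDist z 0) +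
      |β| / (klGridN M : ℕ) * ∑ z : TorusSite 2 L, ‖framePosKernel L Kc z‖ * (1 + torusSiteDist z 0) else 0
    E := fun m' : ℕ => if m' = 1 then |β| / (klGridN M : ℕ) * (fsub Kf Kc).coeffNorm 0 else 0
    hNW0 := towerGrid_inputBudget_nonneg β U Kf
    hNw0 := fun m' => by
      have : 0 < 1 - θb := by linarith
      positivity
    hNV0 := towerGrid_inputBudget_nonneg β U Kc
    hND0 := fun m' => by
      split_ifs
      · positivity
      · exact le_rfl
    hE0 := fun m' => by
      have hc0 : 0 ≤ (fsub Kf Kc).coeffNorm 0 := TrigPolyC4v.coeffNorm_nonneg _ _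
      split_ifs
      · positivity
      · exact le_rfl
    hGBE := fun t ht => isGramBoundedR_add_smul_sub hGBf hGBff hκ0.le ht
    hrowC := rF1
    hcolC := rF2
    hsE := hsE
    hR := hRr
    hCc := hCr
    hNW := towerGrid_inputProfile_le β U Kf
    hνW := towerGrid_normV_inputBudget_le _ hβ0 U Kf (by positivity) hρS.le hFf
    hRK := hRK
    hT := fun X' => rF7 R₀ X'
    hsec := hsec
    hs := norm_uvCovAt_apply_le hKc hβ hβL le_rfl hΛe
    hs' := norm_uvCovAt_apply_le (L := b * L) hKc hβ hβL' le_rfl hΛe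
    hrow := rL1
    hrow' := rF1
    hm1 := rL3
    hm1' := rF6
    hGB := hGBc
    hGB' := hGBf
    hZ := hZ
    hNw := hprof
    hνf := normV_gridOutputMajorant_le _ (by positivity) hρg hΘ₀0 hθb1 hε0 hqf
    hν₂ := normV_gridOutputMajorant_le _ (by positivity) hρg hΘ₀0 hθb1 hε0 hq₂
    hroww := rF4
    hcolw := rF5
    hNV := fun m' => le_rfl
    hND := by rw [if_pos rfl]
    hE := by rw [if_pos rfl]
    heE := hE_norm
    hνD := hND_norm
    hΘ1 := by
      rw [normV_add_profiles]
      have hcap : imagTimeWeight β M * ((Real.exp 2 * (κ + ρ')) ^ 2 * e₀ / 2) ≤ imagTimeWeight β M * ((Real.exp 2 * (κ + ρ')) ^ 2 * ē / 2) :=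
        mul_le_mul_of_nonneg_left (by nlinarith [mul_le_mul_of_nonneg_left hē hw2]) hε0
      linarith [hNV_norm, hND_norm, hE_norm]
    hΘ2 := by
      have hc0 : 0 ≤ (Real.exp 2 * (κ + ρ')) ^ 2 * ē / 2 := by
        have : 0 ≤ ē := ((TrigPolyC4v.coeffNorm_nonneg _ _).trans he₀).trans hē
        positivity
      have h0 := mul_nonneg hε0 hc0
      linarith [hNV_norm, hND_norm] }⟩

end Summit.HubbardSuperconductivity.HubbardSuperconductivity.Theorems.TwoVolumeSource

end
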